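import Summits.ABC.IUTFork.Cor312PilotKummerNaturalModel
import Summits.ABC.IUTFork.Cor312IdentifiedCopies
import HarnessLib

/-!
# [IUTchIII] Cor. 3.12 — the NATURAL (non-identified) model P♮ of the residual `S`, II: typed Thm. 3.11 and the two volumes

Proof-only file (D-0012; no definition, no `Prop` fact) of the abc-iut cell (wave 5, seat abc-iut-w5-d230 gen 4; by-name support
piece for the IUT REPAIR branch, director-abc 2026-08-26T05:11:48Z), sequel of `Cor312PilotKummerNaturalModel` (the model data
P♮). TAKES NO SIDE on [IUTchIII] Cor. 3.12. PROVED HERE, for P♮: §6 the elementary geometry of the two half-shells on the packet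
line (`halfPos ∪ halfNeg = ball`, the non-inclusions among the hull-sets); §7 the log-volume `natVol` is MONOTONE, takes the
values `−3 / −2 / −2 / −1 / 0` on the hull-sets, and is INVARIANT under every family acting by signs — hence under the whole
group ⟨(Ind1)∪(Ind2)⟩ (abc-iut-w4-d101's `actsBySigns_of_mem_closure`); `natData.LogvolInvariant` (abc-iut-c312-1's Step (x) side
condition) holds NON-trivially, the group MOVING the half-shells (`image_halfPos_flipFamily`); §8 the typed [IUTchIII] Theorem
3.11 (i) ∧ (ii) ∧ (iii) HOLDS (`natFull_statement`); §9 the pilot objects are the objects of exponent `1`, the Θ-pilot's Kummer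
images are `halfPos`, the q-pilot's image is `halfNeg`, the possible images are EXACTLY `{halfPos, halfNeg}`, the holomorphic hull
of their union is the shell `ball`, so `−|log(Θ)| = −1`, `−|log(q)| = −2`, `|log(q)| > 0`, all bridge hypotheses hold, and the
printed Statement holds STRICTLY (`natSetting_statement_strict`: `−|log(q)| < −|log(Θ)|`) — by the hull of two distinct
equal-volume possible images ([IUTchIII] Cor. 3.12 proof p. 174 l. 50 – p. 175 l. 1), not by identification. The pins, the
residual `S` and the packaged witness are part III (`Cor312PilotKummerNaturalWitness`). Interface-level toy; typed ≠ proved for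
print; a model of reading predicates endorses no reading. [claim: Mochizuki2012, status: disputed] for every IUT noun.
-/

noncomputable section

open Set

namespace Summit.ABC.IUTFork.Cor312Vol

namespace NaturalWitness

open Thm311 Cor312 Cor312.Checks Cor312.IdentifiedNonVacuity NaiveWitness PinnedWitness Literature.IUT.LogThetaLattice

/-! ## 6. Elementary geometry of the half-shells on the packet line -/

/-- The point of line-coordinate `1` lies in `halfPos`, in `ball`, not in `halfNeg`, and is not `0`. [folklore] -/
theorem lpt_one_mem (j : toyIndex.Label) (vQ : toyIndex.VQ) :
    lpt j vQ 1 ∈ halfPos j vQ ∧ lpt j vQ 1 ∈ ball j vQ ∧ lpt j vQ 1 ∉ halfNeg j vQ ∧ lpt j vQ 1 ≠ 0 := by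
  refine ⟨⟨by simp, by simp⟩, by show |line j vQ (lpt j vQ 1)| ≤ 1; simp, fun h => by have h2 := h.2; simp at h2; norm_num at h2,
    fun h => ?_⟩
  have h1 := congrArg (line j vQ) h
  rw [line_lpt, map_zero] at h1
  exact one_ne_zero h1

/-- The point of line-coordinate `−1` lies in `halfNeg`, in `ball`, not in `halfPos`. [folklore] -/
theorem lpt_neg_one_mem (j : toyIndex.Label) (vQ : toyIndex.VQ) :
    lpt j vQ (-1) ∈ halfNeg j vQ ∧ lpt j vQ (-1) ∈ ball j vQ ∧ lpt j vQ (-1) ∉ halfPos j vQ := by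
  refine ⟨⟨by simp, by simp⟩, by show |line j vQ (lpt j vQ (-1))| ≤ 1; simp, fun h => ?_⟩
  have h1 := h.1; simp at h1; linarith

/-- Non-inclusions among the hull-sets. [folklore] -/
theorem natHul_not_subset (j : toyIndex.Label) (vQ : toyIndex.VQ) :
    ¬ halfPos j vQ ⊆ {0} ∧ ¬ halfNeg j vQ ⊆ {0} ∧ ¬ halfPos j vQ ⊆ halfNeg j vQ ∧ ¬ halfNeg j vQ ⊆ halfPos j vQ ∧
      ¬ ball j vQ ⊆ halfPos j vQ ∧ ¬ ball j vQ ⊆ halfNeg j vQ ∧ ¬ (Set.univ : Set (signShells.Packet j vQ)) ⊆ ball j vQ := by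
  obtain ⟨hp1, hb1, hn1, h10⟩ := lpt_one_mem j vQ
  obtain ⟨hn2, hb2, hp2⟩ := lpt_neg_one_mem j vQ
  refine ⟨fun h => h10 (h hp1), fun h => ?_, fun h => hn1 (h hp1), fun h => hp2 (h hn2), fun h => hp2 (h hb2),
    fun h => hn1 (h hb1), fun h => ball_ne_univ j vQ (Set.eq_univ_of_univ_subset h)⟩
  have h0 : lpt j vQ (-1) = 0 := h hn2
  have h1 := congrArg (line j vQ) h0
  rw [line_lpt, map_zero] at h1
  norm_num at h1

/-- `halfPos ∪ halfNeg = ball`: the shell is the union of its two halves. [folklore] -/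
theorem halfPos_union_halfNeg (j : toyIndex.Label) (vQ : toyIndex.VQ) : halfPos j vQ ∪ halfNeg j vQ = ball j vQ := by
  refine Set.Subset.antisymm (Set.union_subset (halfPos_subset_ball j vQ) (halfNeg_subset_ball j vQ)) fun x hx => ?_
  have h := abs_le.1 (show |line j vQ x| ≤ 1 from hx)
  rcases le_total 0 (line j vQ x) with h0 | h0
  · exact Or.inl ⟨h0, h.2⟩
  · exact Or.inr ⟨h.1, h0⟩

/-! ## 7. The log-volume: values, monotonicity, sign-invariance -/

/-- The volumes of the hull-sets: `−3, −2, −2, −1, 0`. [folklore] -/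
theorem natVol_values (j : toyIndex.Label) (vQ : toyIndex.VQ) :
    natVol j vQ {0} = -3 ∧ natVol j vQ (halfPos j vQ) = -2 ∧ natVol j vQ (halfNeg j vQ) = -2 ∧
      natVol j vQ (ball j vQ) = -1 ∧ natVol j vQ Set.univ = 0 := by
  obtain ⟨h1, h2, h3, h4, h5, h6, h7⟩ := natHul_not_subset j vQ
  unfold natVol
  refine ⟨by rw [if_pos subset_rfl], by rw [if_neg h1, if_pos (Or.inl subset_rfl)],
    by rw [if_neg h2, if_pos (Or.inr subset_rfl)], ?_, ?_⟩
  · rw [if_neg (fun h => h1 ((halfPos_subset_ball j vQ).trans h)), if_neg (fun h => h.elim h5 h6), if_pos subset_rfl]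
  · rw [if_neg (fun h => h1 ((Set.subset_univ _).trans h)),
      if_neg (fun h => h.elim (fun h' => h5 ((Set.subset_univ _).trans h')) fun h' => h6 ((Set.subset_univ _).trans h')),
      if_neg h7]

/-- The log-volume is MONOTONE on all regions. [folklore] -/
theorem natVol_mono {j : toyIndex.Label} {vQ : toyIndex.VQ} {A B : Set (signShells.Packet j vQ)} (hAB : A ⊆ B) :
    natVol j vQ A ≤ natVol j vQ B := by
  unfold natVol
  by_cases hB0 : B ⊆ {0}
  · rw [if_pos (hAB.trans hB0), if_pos hB0]
  rw [if_neg hB0]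
  by_cases hBh : B ⊆ halfPos j vQ ∨ B ⊆ halfNeg j vQ
  · rw [if_pos hBh]
    have hAh : A ⊆ halfPos j vQ ∨ A ⊆ halfNeg j vQ := hBh.imp hAB.trans hAB.trans
    by_cases hA0 : A ⊆ {0}
    · rw [if_pos hA0]; norm_num
    · rw [if_neg hA0, if_pos hAh]
  rw [if_neg hBh]
  by_cases hBb : B ⊆ ball j vQ
  · rw [if_pos hBb]
    by_cases hA0 : A ⊆ {0}
    · rw [if_pos hA0]; norm_num
    rw [if_neg hA0]
    by_cases hAh : A ⊆ halfPos j vQ ∨ A ⊆ halfNeg j vQ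
    · rw [if_pos hAh]; norm_num
    · rw [if_neg hAh, if_pos (hAB.trans hBb)]
  · rw [if_neg hBb]
    split_ifs <;> norm_num

/-- Reflection swaps the half-shells and fixes `{0}`, the shell and everything. [folklore] -/
theorem negSet_hul (j : toyIndex.Label) (vQ : toyIndex.VQ) :
    negSet ({0} : Set (signShells.Packet j vQ)) = {0} ∧ negSet (halfPos j vQ) = halfNeg j vQ ∧
      negSet (halfNeg j vQ) = halfPos j vQ ∧ negSet (ball j vQ) = ball j vQ := by
  refine ⟨?_, ?_, ?_, ?_⟩
  · ext y; simp [negSet]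
  · ext y
    simp only [negSet, halfPos, halfNeg, Set.mem_setOf_eq, map_neg]
    constructor <;> rintro ⟨h1, h2⟩ <;> constructor <;> linarith
  · ext y
    simp only [negSet, halfPos, halfNeg, Set.mem_setOf_eq, map_neg]
    constructor <;> rintro ⟨h1, h2⟩ <;> constructor <;> linarith
  · ext y
    simp only [negSet, ball, Set.mem_setOf_eq, map_neg, abs_neg]

/-- `negSet A ⊆ B ↔ A ⊆ negSet B`. [folklore] -/
theorem negSet_subset_iff {j : toyIndex.Label} {vQ : toyIndex.VQ} (A B : Set (signShells.Packet j vQ)) :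
    negSet A ⊆ B ↔ A ⊆ negSet B :=
  ⟨fun h x hx => h (show -(-x) ∈ A by rw [neg_neg]; exact hx), fun h y hy => by
    have := h hy; rw [negSet, Set.mem_setOf_eq, neg_neg] at this; exact this⟩

/-- Regions with the same position relative to the hull-sets have the same log-volume. [folklore] -/
theorem natVol_eq_of_iff {j : toyIndex.Label} {vQ : toyIndex.VQ} {A B : Set (signShells.Packet j vQ)} (h0 : A ⊆ {0} ↔ B ⊆ {0})
    (hh : (A ⊆ halfPos j vQ ∨ A ⊆ halfNeg j vQ) ↔ (B ⊆ halfPos j vQ ∨ B ⊆ halfNeg j vQ))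
    (hb : A ⊆ ball j vQ ↔ B ⊆ ball j vQ) : natVol j vQ A = natVol j vQ B := by
  unfold natVol
  by_cases a0 : A ⊆ {0}
  · rw [if_pos a0, if_pos (h0.1 a0)]
  rw [if_neg a0, if_neg (fun b0 => a0 (h0.2 b0))]
  by_cases ah : A ⊆ halfPos j vQ ∨ A ⊆ halfNeg j vQ
  · rw [if_pos ah, if_pos (hh.1 ah)]
  rw [if_neg ah, if_neg (fun bh => ah (hh.2 bh))]
  by_cases ab : A ⊆ ball j vQ
  · rw [if_pos ab, if_pos (hb.1 ab)]
  · rw [if_neg ab, if_neg (fun bb => ab (hb.2 bb))]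

/-- The log-volume is invariant under reflection. [folklore] -/
theorem natVol_negSet {j : toyIndex.Label} {vQ : toyIndex.VQ} (A : Set (signShells.Packet j vQ)) :
    natVol j vQ (negSet A) = natVol j vQ A := by
  obtain ⟨h0, hP, hN, hB⟩ := negSet_hul j vQ
  refine natVol_eq_of_iff (by rw [negSet_subset_iff, h0]) ?_ (by rw [negSet_subset_iff, hB])
  rw [negSet_subset_iff, negSet_subset_iff, hP, hN]
  exact Or.comm

/-- **Dichotomy**: a family acting by signs is, on each packet, the identity or `x ↦ −x`. [folklore] -/
theorem id_or_neg_of_actsBySigns {Φ : signShells.PacketAut} (h : ActsBySigns Φ) (j : toyIndex.Label) (vQ : toyIndex.VQ) :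
    (∀ x, Φ j vQ x = x) ∨ (∀ x, Φ j vQ x = -x) := by
  obtain ⟨ε, hε, hΦ⟩ := h.sign j vQ
  rcases (abs_eq (zero_le_one' ℚ)).1 hε with rfl | rfl
  · exact Or.inl fun x => (line j vQ).injective (by rw [hΦ, one_mul])
  · exact Or.inr fun x => (line j vQ).injective (by rw [hΦ, map_neg, neg_one_mul])

/-- The image of a region under a family acting by signs is the region or its reflection. [folklore] -/
theorem image_eq_or_of_actsBySigns {Φ : signShells.PacketAut} (h : ActsBySigns Φ) (j : toyIndex.Label) (vQ : toyIndex.VQ)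
    (A : Set (signShells.Packet j vQ)) : Φ j vQ '' A = A ∨ Φ j vQ '' A = negSet A := by
  rcases id_or_neg_of_actsBySigns h j vQ with hid | hneg
  · left; rw [Set.image_congr fun x _ => hid x, Set.image_id']
  · right; ext y
    simp only [Set.mem_image, negSet, Set.mem_setOf_eq]
    constructor
    · rintro ⟨x, hx, rfl⟩; rw [hneg, neg_neg]; exact hx
    · intro hy; exact ⟨-y, hy, by rw [hneg, neg_neg]⟩

/-- **The log-volume is invariant under every family acting by signs** — in particular under every element of
⟨(Ind1)∪(Ind2)⟩ (abc-iut-w4-d101's `actsBySigns_of_mem_closure`): Step (x) of the printed proof holds in P♮ non-trivially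
(the group MOVES the half-shells). [folklore] -/
theorem natVol_image_of_actsBySigns {Φ : signShells.PacketAut} (h : ActsBySigns Φ) (j : toyIndex.Label) (vQ : toyIndex.VQ)
    (A : Set (signShells.Packet j vQ)) : natVol j vQ (Φ j vQ '' A) = natVol j vQ A := by
  rcases image_eq_or_of_actsBySigns h j vQ A with e | e
  · rw [e]
  · rw [e, natVol_negSet]

/-- `LogvolInvariant` of the data of P♮ (abc-iut-c312-1's named side condition of Step (x)), PROVED. [folklore] -/
theorem natData_logvolInvariant : natData.LogvolInvariant := fun Φ hΦ j vQ A _ => by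
  rcases hΦ with h1 | h2
  · exact natVol_image_of_actsBySigns (actsBySigns_of_mem_Ind1Family h1) j vQ A
  · exact natVol_image_of_actsBySigns (actsBySigns_of_mem_Ind2Family h2) j vQ A

/-- `flipFamily` maps `halfPos` onto `halfNeg`. [folklore] -/
theorem image_halfPos_flipFamily (j : toyIndex.Label) (vQ : toyIndex.VQ) :
    flipFamily j vQ '' halfPos j vQ = halfNeg j vQ := by
  rw [← (negSet_hul j vQ).2.1]
  ext y
  simp only [Set.mem_image, negSet, Set.mem_setOf_eq]
  constructor
  · rintro ⟨x, hx, rfl⟩; rw [flipFamily_apply, neg_neg]; exact hx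
  · intro hy; exact ⟨-y, hy, by rw [flipFamily_apply, neg_neg]⟩

/-! ## 8. The typed Theorem 3.11 (i) ∧ (ii) ∧ (iii) HOLDS for P♮ -/

/-- (i): the splitting monoid sits in the sub-packets; the degree `−1` IS the global log-volume of `ball`; the classes
`^{n,∘}𝔯^{LGP}` coincide (bi-coric strictification). [folklore] -/
theorem nat_partI : natFull.PartI := by
  refine ⟨fun n v hv x _ j => ?_, fun n j k => ⟨fun vQ => trivial, Set.toFinite _, ?_⟩, fun _ _ => rfl⟩
  · show x j ∈ signShells.SubPacket j.1 v
    rw [subPacket_eq_top]; trivial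
  · show (-1 : ℝ) = ∑ᶠ vQ : toyIndex.VQ, natVol j.1 vQ (ball j.1 vQ)
    rw [finsum_unique]
    exact (natVol_values j.1 _).2.2.2.1.symm

/-- (ii), column by column: identity Kummer transport (KummerA/B/C by `rfl`), (Ind3) = `ball ⊆ ball`, no archimedean place.
[folklore] -/
theorem nat_partII : natFull.toLatticeSituation.PartII := fun _ =>
  (Column.partII_iff _ _).2
    ⟨fun _ _ _ _ _ => ⟨trivial, rfl⟩, fun _ _ _ => rfl, fun _ _ => rfl, fun _ _ _ _ _ => subset_rfl,
      fun _ _ _ h => absurd trivial h⟩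

/-- (iii): the link data are abc-iut-w5-d247's `naiveLink` (squares of full poly-isomorphisms commute; `(−1)^m` is
`ℤˣ`-equivariant; full permutation poly-isomorphisms are stabilized). [folklore] -/
theorem nat_partIII : natFull.PartIII := by
  refine ⟨naiveLink.partIIIa_holds, naiveLink.partIIIb_holds, ?_, fun n m => Thm311.PolyIsoCalc.stabilized_full _ _,
    natFull.evalCompatUpToInd_of_multiradialCompat nat_partI.2.2⟩
  refine naiveLink.partIIIc_of_full (fun _ => rfl) fun n m => ?_
  rintro _ ⟨a, rfl⟩
  show unitIso a ≪≫ unitIso ((-1) ^ m.natAbs) = unitIso ((-1) ^ m.natAbs) ≪≫ unitIso a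
  rw [unitIso_trans, unitIso_trans, mul_comm]

/-- **The typed Theorem 3.11 (i) ∧ (ii) ∧ (iii) HOLDS in P♮.** [folklore] -/
theorem natFull_statement : natFull.Statement := ⟨nat_partI, nat_partII, nat_partIII⟩

/-! ## 9. The pilot objects and the regions of P♮, COMPUTED -/

/-- The Θ-pilot object is the lgp-object of exponent `1` (for whichever generator up to torsion Def. 3.8 (i) picks) and the
q-pilot object is the `△`-object of exponent `1`. [folklore] -/
theorem natSetting_pilots : natSetting.thetaPilot = (1 : ℤ) ∧ natSetting.qPilot = (1 : ℤ) :=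
  ⟨congrArg (Nat.cast : ℕ → ℤ)
    (expOf_eq_one_of_isGenerator_top (Classical.choose_spec (natSetting.split.exists_gen () (Set.mem_univ ())))), rfl⟩

/-- The Kummer image of the Θ-pilot at every `(m, j, v_ℚ)`, `j ∈ 𝔽_l^⋇`, is `halfPos`; at the zero label it is `{0}`. [folklore] -/
theorem natSetting_thetaRegion (m : ℤ) (j : toyIndex.Label) (vQ : toyIndex.VQ) :
    natSetting.thetaRegion m j vQ = thetaRegionNat 1 j vQ := by
  unfold Setting.thetaRegion; rw [natSetting_pilots.1]; rfl

/-- The (Ind3)-enlarged Θ-region is the same (no `m`-drift). [folklore] -/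
theorem natSetting_thetaRegion3 (j : toyIndex.Label) (vQ : toyIndex.VQ) :
    natSetting.thetaRegion3 j vQ = thetaRegionNat 1 j vQ := by
  show (⋃ m : ℤ, natSetting.thetaRegion m j vQ) = _
  simp_rw [natSetting_thetaRegion]; exact Set.iUnion_const _

/-- The q-pilot image is `qRegionNat 1` (`halfNeg` on `𝔽_l^⋇`). [folklore] -/
theorem natSetting_qRegion (j : toyIndex.Label) (vQ : toyIndex.VQ) : natSetting.qRegion j vQ = qRegionNat 1 j vQ := rfl

/-- On `𝔽_l^⋇`: Θ-region `halfPos`, q-region `halfNeg`. [folklore] -/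
theorem natSetting_regions_of_ne_zero {j : toyIndex.Label} (hj : j ≠ 0) (vQ : toyIndex.VQ) :
    natSetting.thetaRegion3 j vQ = halfPos j vQ ∧ natSetting.qRegion j vQ = halfNeg j vQ := by
  rw [natSetting_thetaRegion3, natSetting_qRegion, thetaRegionNat_one_of_ne_zero hj, qRegionNat_one_of_ne_zero hj]
  exact ⟨rfl, rfl⟩

/-- `flipFamily` lies in the (Ind1)(Ind2)-group of the situation. [folklore] -/
theorem flipFamily_mem_indGroup : flipFamily ∈ Setting.indGroup natSituation :=
  Subgroup.subset_closure (Or.inr flipFamily_mem_Ind2Family)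

/-- **The possible images of the Θ-pilot at a label of `𝔽_l^⋇` are EXACTLY the two half-shells** (every element of
⟨(Ind1)∪(Ind2)⟩ acts by a sign; the identity gives `halfPos`, `flipFamily` gives `halfNeg`). [folklore] -/
theorem natSetting_possibleImages {j : toyIndex.Label} (hj : j ≠ 0) (vQ : toyIndex.VQ) :
    natSetting.possibleImages j vQ = {halfPos j vQ, halfNeg j vQ} := by
  ext U
  rw [Setting.possibleImages, (natSetting_regions_of_ne_zero hj vQ).1]
  constructor
  · rintro ⟨Φ, hΦ, rfl⟩
    rcases image_eq_or_of_actsBySigns (actsBySigns_of_mem_closure hΦ) j vQ (halfPos j vQ) with e | e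
    · exact Or.inl e
    · rw [e, (negSet_hul j vQ).2.1]; exact Or.inr rfl
  · rintro (rfl | rfl)
    · exact ⟨1, (Setting.indGroup natSituation).one_mem, by simp⟩
    · exact ⟨flipFamily, flipFamily_mem_indGroup, (image_halfPos_flipFamily j vQ).symm⟩

/-- The union of the possible images at a label of `𝔽_l^⋇` is the whole shell. [folklore] -/
theorem natSetting_sUnion_possibleImages {j : toyIndex.Label} (hj : j ≠ 0) (vQ : toyIndex.VQ) :
    ⋃₀ natSetting.possibleImages j vQ = ball j vQ := by
  rw [natSetting_possibleImages hj, Set.sUnion_insert, Set.sUnion_singleton, halfPos_union_halfNeg]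

/-- **The holomorphic hull `ⁿ˒°𝒰_{j,v_ℚ}` of the union of the possible images is the shell `ball`** — a hull-set STRICTLY larger
than each possible image. [folklore] -/
theorem natSetting_thetaHull {j : toyIndex.Label} (hj : j ≠ 0) (vQ : toyIndex.VQ) : natSetting.thetaHull j vQ = ball j vQ := by
  unfold Setting.thetaHull
  rw [natSetting_sUnion_possibleImages hj]
  exact (natFrame j vQ).hull_eq_self_of_mem (ball_mem_natHul j vQ)

/-- Every union of possible images admits its hull (all regions relatively compact, all admit a hull). [folklore] -/
theorem natSetting_hullDefined (j : toyIndex.Label) (vQ : toyIndex.VQ) : natSetting.HullDefined j vQ := ⟨trivial, trivial⟩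

/-- The local Θ-contribution at a label of `𝔽_l^⋇` is `−1` (the volume of the shell). [folklore] -/
theorem natSetting_thetaLocal (i : Fin toyIndex.lstar) (vQ : toyIndex.VQ) :
    natSetting.thetaLocal (Setting.labelSucc i) vQ = ((-1 : ℝ) : WithTop ℝ) := by
  unfold Setting.thetaLocal
  rw [if_pos (natSetting_hullDefined _ vQ), natSetting_thetaHull (Setting.labelSucc_ne_zero i)]
  exact congrArg _ (natVol_values _ vQ).2.2.2.1

/-- The local q-contribution at a label of `𝔽_l^⋇` is `−2` (the volume of a half-shell). [folklore] -/
theorem natSetting_qLocal (i : Fin toyIndex.lstar) (vQ : toyIndex.VQ) : natSetting.qLocal (Setting.labelSucc i) vQ = -2 := by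
  unfold Setting.qLocal
  rw [(natSetting_regions_of_ne_zero (Setting.labelSucc_ne_zero i) vQ).2]
  exact (natVol_values _ vQ).2.2.1

/-- `−|log(Θ)|` is finite. [folklore] -/
theorem natSetting_thetaFinite : natSetting.ThetaFinite :=
  ⟨fun i vQ => by rw [natSetting_thetaLocal]; exact WithTop.coe_ne_top, fun _ => Set.toFinite _⟩

/-- **`−|log(Θ)| = −1`.** [folklore] -/
theorem natSetting_negLogTheta : natSetting.negLogTheta = ((-1 : ℝ) : WithTop ℝ) := by
  rw [natSetting.negLogTheta_eq_of_thetaFinite natSetting_thetaFinite]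
  simp only [natSetting_thetaLocal, WithTop.untopD_coe, finsum_unique]
  exact congrArg _ (processionNormalized_const (by decide) (-1))

/-- **`−|log(q)| = −2`.** [folklore] -/
theorem natSetting_negLogQ : natSetting.negLogQ = -2 := by
  unfold Setting.negLogQ
  simp only [natSetting_qLocal, finsum_unique]
  exact processionNormalized_const (by decide) (-2)

/-- **`|log(q)| > 0`.** [folklore] -/
theorem natSetting_absLogQPos : natSetting.AbsLogQPos := by
  show natSetting.negLogQ < 0; rw [natSetting_negLogQ]; norm_num

/-- **The printed Statement of Cor. 3.12 HOLDS in P♮, STRICTLY: `−|log(q)| = −2 < −1 = −|log(Θ)|`** — the inequality comes from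
the hull of two distinct equal-volume possible images, not from identification. [folklore] -/
theorem natSetting_statement_strict :
    natSetting.Statement ∧ ((natSetting.negLogQ : ℝ) : WithTop ℝ) < natSetting.negLogTheta := by
  refine ⟨(natSetting.statement_iff_real natSetting_negLogTheta).2 (by rw [natSetting_negLogQ]; norm_num), ?_⟩
  rw [natSetting_negLogTheta, natSetting_negLogQ, WithTop.coe_lt_coe]; norm_num

/-- **All bridge hypotheses hold** (monotone volume, admissible images, nonempty hull-sets and Θ-regions, finiteness). [folklore] -/
theorem natSetting_bridgeHyps : BridgeHyps natSetting where
  mono := fun _ _ _ _ _ _ hAB => natVol_mono hAB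
  image_adm := fun _ _ _ _ => trivial
  image_fin := fun _ => Set.toFinite _
  hul_nonempty := fun _ _ _ hH => ⟨0, zero_mem_of_mem_natHul hH⟩
  theta_nonempty := fun i vQ => by
    rw [(natSetting_regions_of_ne_zero (Setting.labelSucc_ne_zero i) vQ).1]; exact ⟨0, zero_mem_halfPos _ vQ⟩
  finite := natSetting_thetaFinite

/-- Every Kummer image of the Θ-pilot is admissible. [folklore] -/
theorem natSetting_thetaRegionsAdm : ThetaRegionsAdm natSetting := fun _ _ _ => trivial

end NaturalWitness

end Summit.ABC.IUTFork.Cor312Vol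

end
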